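import Summits.HodgeConjecture.HodgeConjecture.Theorems.EightfoldBlochSeedsChernCharacterOnBettiAnalytificationFrames
import HarnessLib

/-!
# K1 (analytification bridge), step 2: the topological analytification `F(ℂ) → X(ℂ)` of an
# algebraic vector bundle EXISTS, with Serre's comparison map (GAGA §3 n°9, §4 n°20; FAC n°41)

Route `EightfoldBlochSeeds` / item `stmt-HodgeConjecture-19780` (`ChernCharacterOnBetti`), helper
(`--supports`). HONEST FRAMING: nothing here proves 19780 / 18880 / 18882 / 18883 / H2 / HC_AV / HC;
no definition, no named fact. This is the EXISTENCE half of the "analytification bridge" K1 named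
in `CENSUS-K5-leafhand-1-g3.md` (the tree had the GAGA comparison PREDICATE
`HodgeTheory.IsAnalytifiedVectorBundle` / the DATA type `AnalytifiedVectorBundle`, whose module
docstring says "Not here (deliberately): the existence theorem `F ↦ F^an` … needs the cocycle
`g_{ij} ∘ ψ` packaged as a `VectorBundleCore`", and the topological Chern classes
`CharacteristicClasses.chernClassR` / `chernClassZ` of bundled `ComplexVectorBundle`s; it had no
construction of the topological bundle `E(ℂ) → X(ℂ)` underlying an algebraic vector bundle).

WHAT.

* `exists_vectorBundleCore_analytification` — for an `𝒪_X`-module `F` on a `ℂ`-scheme `X` which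
  is locally free of rank `r` (every scheme point lies in a Zariski open carrying an algebraic frame
  `s₁, …, s_r`, `HodgeTheory.IsSectionFrame`), the evaluated transition matrices `g_{s→t}(P)` of
  the algebraic frames form a Mathlib `VectorBundleCore ℂ X(ℂ) ℂʳ` on the complex points with the
  analytic topology (charts = frames, base sets `U(ℂ)`): identity on the diagonal, continuous
  (regular functions are continuous on `X(ℂ)`), cocycle (`eval_repr_change`).
* `exists_topologicalAnalytification` — hence a complex topological vector bundle `E` of rank `r`
  on `X(ℂ)` (`ComplexVectorBundle`, Husemoller Ch. 3) with comparison maps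
  `α_U : Γ(F, U) → sections of E`, additive, `𝒪_X`-linear, restriction-compatible, CONTINUOUS on
  `U(ℂ)`, carrying algebraic frames to fibrewise bases — Serre's `(F^h, α : F' → F^h)` read
  topologically on the base `X(ℂ)` itself (every field of `IsAnalytifiedVectorBundle` except
  holomorphy, which needs a complex-manifold structure on the base and is not used by Chern classes).

Consumers: the Chern classes `chernClassZ E i ∈ H²ⁱ(X(ℂ); ℤ)` / `E.chernClassR ℂ i ∈ complexBetti X (2i)`
of this `E` are the Betti Chern classes of the algebraic bundle `F` (next file); with the frame
clause, `HodgeTheory.chernClassZ_restrictToCompl_eq_zero_of_frame` applies verbatim.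
[cite: SerreGAGA1956, §3 n°9 Déf. 2 and §4 n°20] [cite: SerreFAC1955, n°41]
[cite: HusemollerFibreBundles1994, Ch. 3 §1 and Ch. 5 (coordinate description)]
-/

noncomputable section

-- single-problem summit (Problem = Summit): the mandated namespace repeats `HodgeConjecture`.
set_option linter.dupNamespace false

open CategoryTheory AlgebraicGeometry
open Literature.AlgebraicGeometry.Motives Literature.AlgebraicGeometry.HodgeTheory


namespace Summit.HodgeConjecture.HodgeConjecture.Theorems

open Bundle Topology Filter
open scoped Matrix
open Literature.AlgebraicTopology.SingularHomology Literature.AlgebraicTopology.CharacteristicClasses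

variable {X : SchemeOver ℂ} {F : X.left.Modules} {r : ℕ}

/-- **The analytification cocycle as a Mathlib `VectorBundleCore` on `X(ℂ)`** (Serre, GAGA §4 n°20:
"tout espace fibré algébrique `E` définit un espace fibré analytique `E^h`"; FAC n°41: a locally
free sheaf with frames `(U_i, s^{(i)})` is the sheaf of sections of the fibre space with
transition matrices `g_{ij}`). Charts are indexed by the algebraic frames `(U, s)` of `F` of size
`r`; the base set of `(U, s)` is `U(ℂ)`; the coordinate change `(U, s) → (W, t)` at `P` is the
evaluated transition matrix `g_{s→t}(P)`. If every scheme point of `X` lies in the open of some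
frame of size `r` (i.e. `F` is locally free of rank `r`), this is a vector bundle core: the
identity on the diagonal (`eval_repr_self`), continuous (`AlgPoints.continuousOn_evalOrZero`:
regular functions are continuous for the analytic topology), and a cocycle (`eval_repr_change`).
Stated as an existence with the two characterising equations (base sets, coordinate changes).
[cite: SerreGAGA1956, §4 n°20] [cite: SerreFAC1955, n°41] -/
theorem exists_vectorBundleCore_analytification
    (hF : ∀ x : X.left, ∃ (U : X.left.Opens) (s : Fin r → Γ(F, U)), x ∈ U ∧ IsSectionFrame F U s) :
    ∃ Z : VectorBundleCore ℂ (ComplexPoints X) (Fin r → ℂ)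
        (Σ U : X.left.Opens, {s : Fin r → Γ(F, U) // IsSectionFrame F U s}),
      (∀ i, Z.baseSet i = {P | P.pt ∈ i.1}) ∧
      ∀ i j (P : ComplexPoints X) (v : Fin r → ℂ), Z.coordChange i j P v =
        (Matrix.of fun l k ↦ AlgPoints.evalOrZero (i.1 ⊓ j.1)
          ((j.2.2.of_le inf_le_right).basis.repr
            (F.presheaf.map (homOfLE inf_le_left).op (i.2.1 k)) l) P) *ᵥ v := by
  classical
  choose U s hxU hs using hF
  refine ⟨{ baseSet := fun i ↦ {P | P.pt ∈ i.1}
            isOpen_baseSet := fun i ↦ AlgPoints.isOpen_setOf_pt_mem i.1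
            indexAt := fun P ↦ ⟨U P.pt, s P.pt, hs P.pt⟩
            mem_baseSet_at := fun P ↦ hxU P.pt
            coordChange := fun i j P ↦ LinearMap.toContinuousLinearMap (Matrix.mulVecLin
              (Matrix.of fun l k ↦ AlgPoints.evalOrZero (i.1 ⊓ j.1)
                ((j.2.2.of_le inf_le_right).basis.repr
                  (F.presheaf.map (homOfLE inf_le_left).op (i.2.1 k)) l) P))
            coordChange_self := ?_
            continuousOn_coordChange := ?_
            coordChange_comp := ?_ }, fun i ↦ rfl, fun i j P v ↦ ?_⟩
  · -- the diagonal: `g_{s→s}(P) = 1`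
    intro i P hP v
    rw [LinearMap.coe_toContinuousLinearMap', Matrix.mulVecLin_apply]
    have h1 : (Matrix.of fun l k ↦ AlgPoints.evalOrZero (i.1 ⊓ i.1)
        ((i.2.2.of_le inf_le_right).basis.repr
          (F.presheaf.map (homOfLE inf_le_left).op (i.2.1 k)) l) P) = 1 := by
      ext l k
      rw [Matrix.of_apply]
      exact eval_repr_self i.2.2 hP k l
    rw [h1, Matrix.one_mulVec]
  · -- continuity: entries are regular functions evaluated at complex points
    intro i j
    refine continuousOn_clm_apply.2 fun v ↦ ?_
    simp only [LinearMap.coe_toContinuousLinearMap', Matrix.mulVecLin_apply]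
    refine continuousOn_pi.2 fun l ↦ ?_
    simp only [Matrix.mulVec, dotProduct, Matrix.of_apply]
    exact continuousOn_finsetSum _ fun k _ ↦
      ((AlgPoints.continuousOn_evalOrZero (i.1 ⊓ j.1) _).mono fun P hP ↦
        show P.pt ∈ i.1 ⊓ j.1 from ⟨hP.1, hP.2⟩).mul continuousOn_const
  · -- the cocycle rule `g_{t→u}(P) g_{s→t}(P) = g_{s→u}(P)`
    rintro i j k P ⟨⟨hi, hj⟩, hk⟩ v
    simp only [LinearMap.coe_toContinuousLinearMap', Matrix.mulVecLin_apply, Matrix.mulVec_mulVec]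
    congr 1
    ext l a
    rw [Matrix.mul_apply]
    simp only [Matrix.of_apply]
    exact eval_repr_change j.2.2 k.2.2 (i.2.1 a) hi hj hk l
  · rw [LinearMap.coe_toContinuousLinearMap', Matrix.mulVecLin_apply]

/-- **K1, existence of the topological analytification `F(ℂ) → X(ℂ)` with Serre's comparison map**
(GAGA §3 n°9 Déf. 2, `F^h = F' ⊗_{𝒪'} 𝓗` with `α : F' → F^h`; §4 n°20; FAC n°41), for an
`𝒪_X`-module `F` on a `ℂ`-scheme `X` which is LOCALLY FREE OF RANK `r` in the sense that every
point of `X` lies in a Zariski open carrying an algebraic frame `s₁, …, s_r` of `F`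
(`HodgeTheory.IsSectionFrame`). There are a complex topological vector bundle `E` of rank `r` on
the complex points `X(ℂ)` with the analytic topology (the tree's bundled `ComplexVectorBundle`,
i.e. Mathlib's `FiberBundle`/`VectorBundle ℂ`) and comparison maps `α_U : Γ(F, U) → (sections of
E over U(ℂ))` which are additive, `𝒪_X`-linear (`α(f • σ)(P) = f(P) α(σ)(P)`), compatible with
restriction, CONTINUOUS on `U(ℂ)`, and carry every algebraic frame of `F` over `U` to a basis of
each fibre `E_P`, `P ∈ U(ℂ)` — the topological content of the GAGA comparison predicate
`HodgeTheory.IsAnalytifiedVectorBundle` (all its fields except holomorphy, on the base `X(ℂ)`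
itself). Construction: the vector bundle of the core `exists_vectorBundleCore_analytification`;
`α_U(σ)(P)` = the coordinates of `σ` in the chart frame at `P`, evaluated at `P`.
[cite: SerreGAGA1956, §3 n°9 Déf. 2 and §4 n°20] [cite: SerreFAC1955, n°41] -/
theorem exists_topologicalAnalytification
    (hF : ∀ x : X.left, ∃ (U : X.left.Opens) (s : Fin r → Γ(F, U)), x ∈ U ∧ IsSectionFrame F U s) :
    ∃ (E : ComplexVectorBundle.{0, 0} (ComplexPoints X))
      (α : ∀ U : X.left.Opens, Γ(F, U) → ∀ P : ComplexPoints X, E.E P),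
      E.rank = r ∧
      (∀ (U : X.left.Opens) (σ τ : Γ(F, U)) (P : ComplexPoints X),
          α U (σ + τ) P = α U σ P + α U τ P) ∧
      (∀ (U : X.left.Opens) (f : Γ(X.left, U)) (σ : Γ(F, U)) (P : ComplexPoints X) (h : P.pt ∈ U),
          α U (f • σ) P = P.eval U h f • α U σ P) ∧
      (∀ (U W : X.left.Opens) (hWU : W ≤ U) (σ : Γ(F, U)) (P : ComplexPoints X), P.pt ∈ W →
          α W (F.presheaf.map (homOfLE hWU).op σ) P = α U σ P) ∧
      (∀ (U : X.left.Opens) (σ : Γ(F, U)),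
          ContinuousOn (fun P ↦ (⟨P, α U σ P⟩ : TotalSpace E.F E.E)) {P | P.pt ∈ U}) ∧
      (∀ (U : X.left.Opens) (t : Fin r → Γ(F, U)), IsSectionFrame F U t → ∀ P : ComplexPoints X,
          P.pt ∈ U → LinearIndependent ℂ (fun j ↦ α U (t j) P) ∧
            ⊤ ≤ Submodule.span ℂ (Set.range fun j ↦ α U (t j) P)) := by
  classical
  obtain ⟨Z, hbs, hcc⟩ := exists_vectorBundleCore_analytification hF
  have hidx : ∀ P : ComplexPoints X, P.pt ∈ (Z.indexAt P).1 := fun P ↦ by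
    have h := Z.mem_baseSet_at P
    rw [hbs] at h
    exact h
  refine ⟨{ F := Fin r → ℂ, E := Z.Fiber }, fun U σ P ↦
    (fun k ↦ AlgPoints.evalOrZero (U ⊓ (Z.indexAt P).1)
      (((Z.indexAt P).2.2.of_le inf_le_right).basis.repr
        (F.presheaf.map (homOfLE inf_le_left).op σ) k) P : Fin r → ℂ),
    ?_, ?_, ?_, ?_, ?_, ?_⟩
  · -- rank
    show Module.finrank ℂ (Fin r → ℂ) = r
    simp
  · -- additivity
    intro U σ τ P
    exact funext fun k ↦ eval_repr_add (Z.indexAt P).2.2 σ τ P k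
  · -- `𝒪_X`-linearity
    intro U f σ P h
    refine funext fun k ↦ ?_
    rw [← AlgPoints.evalOrZero_of_mem f h]
    exact eval_repr_smul (Z.indexAt P).2.2 f σ h (hidx P) k
  · -- restriction
    intro U W hWU σ P hW
    exact funext fun k ↦ eval_repr_res (Z.indexAt P).2.2 hWU σ hW (hidx P) k
  · -- continuity on `U(ℂ)`: in the chart at `P₀` the section reads `σ_{s_{P₀}}(P)`, regular in `P`
    intro U σ P₀ hP₀
    refine (FiberBundle.continuousWithinAt_totalSpace _ _).2 ⟨continuousWithinAt_id, ?_⟩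
    have key : ∀ P : ComplexPoints X, P.pt ∈ U → P.pt ∈ (Z.indexAt P₀).1 →
        ((trivializationAt (Fin r → ℂ) Z.Fiber P₀)
          ⟨P, (fun k ↦ AlgPoints.evalOrZero (U ⊓ (Z.indexAt P).1)
            (((Z.indexAt P).2.2.of_le inf_le_right).basis.repr
              (F.presheaf.map (homOfLE inf_le_left).op σ) k) P : Fin r → ℂ)⟩).2 =
        fun l ↦ AlgPoints.evalOrZero (U ⊓ (Z.indexAt P₀).1)
          (((Z.indexAt P₀).2.2.of_le inf_le_right).basis.repr
            (F.presheaf.map (homOfLE inf_le_left).op σ) l) P := by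
      intro P hU h0
      show Z.coordChange (Z.indexAt P) (Z.indexAt P₀) P _ = _
      rw [hcc]
      funext l
      simp only [Matrix.mulVec, dotProduct, Matrix.of_apply]
      exact eval_repr_change (Z.indexAt P).2.2 (Z.indexAt P₀).2.2 σ hU (hidx P) h0 l
    have hnhds : {P : ComplexPoints X | P.pt ∈ U ∧ P.pt ∈ (Z.indexAt P₀).1} ∈
        𝓝[{P : ComplexPoints X | P.pt ∈ U}] P₀ :=
      Filter.mem_of_superset (Filter.inter_mem self_mem_nhdsWithin
        (mem_nhdsWithin_of_mem_nhds ((AlgPoints.isOpen_setOf_pt_mem _).mem_nhds (hidx P₀))))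
        fun P hP ↦ ⟨hP.1, hP.2⟩
    refine ContinuousWithinAt.congr_of_eventuallyEq
      (f := fun P l ↦ AlgPoints.evalOrZero (U ⊓ (Z.indexAt P₀).1)
          (((Z.indexAt P₀).2.2.of_le inf_le_right).basis.repr
            (F.presheaf.map (homOfLE inf_le_left).op σ) l) P) ?_ ?_ ?_
    · have hft : ContinuousOn (fun (P : ComplexPoints X) (l : Fin r) ↦
          AlgPoints.evalOrZero (U ⊓ (Z.indexAt P₀).1)
            (((Z.indexAt P₀).2.2.of_le inf_le_right).basis.repr
              (F.presheaf.map (homOfLE inf_le_left).op σ) l) P)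
          {P | P.pt ∈ U ⊓ (Z.indexAt P₀).1} :=
        continuousOn_pi.2 fun l ↦ AlgPoints.continuousOn_evalOrZero _ _
      exact (hft P₀ ⟨hP₀, hidx P₀⟩).mono_of_mem_nhdsWithin hnhds
    · exact Filter.eventuallyEq_of_mem hnhds fun P hP ↦ key P hP.1 hP.2
    · exact key P₀ hP₀ (hidx P₀)
  · -- frames go to bases: the vectors are the columns of the invertible matrix `g_{t→s_P}(P)`
    intro U t ht P hP
    -- `N = g_{t → s_P}(P)`, `M' = g_{s_P → t}(P)`, mutually inverse by the cocycle rule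
    have hinv₁ : ∀ w : Fin r → ℂ,
        Z.coordChange (Z.indexAt P) ⟨U, t, ht⟩ P (Z.coordChange ⟨U, t, ht⟩ (Z.indexAt P) P w) = w := by
      intro w
      rw [Z.coordChange_comp ⟨U, t, ht⟩ (Z.indexAt P) ⟨U, t, ht⟩ P
        ⟨⟨by rw [hbs]; exact hP, Z.mem_baseSet_at P⟩, by rw [hbs]; exact hP⟩ w,
        Z.coordChange_self _ P (by rw [hbs]; exact hP)]
    have hinv₂ : ∀ w : Fin r → ℂ,
        Z.coordChange ⟨U, t, ht⟩ (Z.indexAt P) P (Z.coordChange (Z.indexAt P) ⟨U, t, ht⟩ P w) = w := by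
      intro w
      rw [Z.coordChange_comp (Z.indexAt P) ⟨U, t, ht⟩ (Z.indexAt P) P
        ⟨⟨Z.mem_baseSet_at P, by rw [hbs]; exact hP⟩, Z.mem_baseSet_at P⟩ w,
        Z.coordChange_self _ P (Z.mem_baseSet_at P)]
    let e : (Fin r → ℂ) ≃ₗ[ℂ] (Fin r → ℂ) :=
      { toLinearMap := (Z.coordChange ⟨U, t, ht⟩ (Z.indexAt P) P : (Fin r → ℂ) →ₗ[ℂ] (Fin r → ℂ))
        invFun := Z.coordChange (Z.indexAt P) ⟨U, t, ht⟩ P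
        left_inv := hinv₁
        right_inv := hinv₂ }
    let b : Module.Basis (Fin r) ℂ (Fin r → ℂ) := (Pi.basisFun ℂ (Fin r)).map e
    have hb : ∀ j, b j = (fun k ↦ AlgPoints.evalOrZero (U ⊓ (Z.indexAt P).1)
        (((Z.indexAt P).2.2.of_le inf_le_right).basis.repr
          (F.presheaf.map (homOfLE inf_le_left).op (t j)) k) P : Fin r → ℂ) := by
      intro j
      show Z.coordChange ⟨U, t, ht⟩ (Z.indexAt P) P (Pi.basisFun ℂ (Fin r) j) = _
      rw [Pi.basisFun_apply, hcc, Matrix.mulVec_single_one]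
      rfl
    have hv : (fun j ↦ (fun k ↦ AlgPoints.evalOrZero (U ⊓ (Z.indexAt P).1)
        (((Z.indexAt P).2.2.of_le inf_le_right).basis.repr
          (F.presheaf.map (homOfLE inf_le_left).op (t j)) k) P : Fin r → ℂ)) = ⇑b :=
      funext fun j ↦ (hb j).symm
    refine ⟨?_, ?_⟩
    · have := b.linearIndependent
      rw [← hv] at this
      exact this
    · have := b.span_eq
      rw [← hv] at this
      exact this.ge

end Summit.HodgeConjecture.HodgeConjecture.Theorems

end
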